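import Mathlib
import HarnessLib
import Summits.HubbardSuperconductivity.HubbardSuperconductivity.Theorems.ThermalWedgeTwSeededEnsembleEquivalenceRSourcedPressureLimit

/-!
# Route `ThermalWedge`, crux `TwSeededEnsembleEquivalenceR` (stmt-HubbardSuperconductivity-15581):
# by-product — the thermodynamic limit of the grand-canonical PRESSURE of the 2D Hubbard torus

Support file (`--supports stmt-HubbardSuperconductivity-15581`; no definition; the route file is NOT imported).
The `h = 0` instance of `stub_sourcedPressureLimit` (`dWaveSourceTorus L U μ 0 = hubbardTorusWith 2 L 1 U μ`): for all real
`β > 0`, `U`, `μ`, the finite-volume pressure `log Re Tr e^{-β(H_L(1,U) - μN)}/(βL²)` of the Hubbard model on the torus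
`(ℤ/Lℤ)²` converges as `L → ∞` — the positive-temperature companion of the tree's ground-state-energy limit
`stub_torusGcEnergyDensityLimit` (route `WeakCouplingBCS`), usable by every item of the route that speaks of "the limiting
pressure" of the pure model (cruxes 1696/1697/1702). Ruelle, *Statistical Mechanics: Rigorous Results* (1969) §2.2–2.3. [folklore]
-/

set_option linter.dupNamespace false

namespace Summit.HubbardSuperconductivity.HubbardSuperconductivity.Theorems

open Literature.MathematicalPhysics.QuantumLattice

/-- **Thermodynamic limit of the pressure of the 2D Hubbard torus** (registered sub-goal
`twR_hubbardTorusPressureLimit` of stmt-HubbardSuperconductivity-15581): for all real `β > 0`, `U`, `μ`,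
`log Re Z_β(hubbardTorusWith 2 L 1 U μ)/(βL²)` converges as `L → ∞` (ε–L₀ form). [folklore] -/
theorem twR_hubbardTorusPressureLimit : ∀ (β U μ : ℝ), 0 < β → ∃ q : ℝ, ∀ κ : ℝ, 0 < κ → ∃ L₀ : ℕ, ∀ (L : ℕ) [NeZero L], L₀ ≤ L → |Real.log (Matrix.partitionFn β (hubbardTorusWith 2 L 1 U μ)).re / (β * (L : ℝ) ^ 2) - q| ≤ κ := by
  intro β U μ hβ
  obtain ⟨q, hq⟩ := stub_sourcedPressureLimit β U μ 0 hβ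
  refine ⟨q, fun κ hκ => ?_⟩
  obtain ⟨L₀, hL₀⟩ := hq κ hκ
  refine ⟨L₀, fun L _ hL => ?_⟩
  have h := hL₀ L hL
  rwa [dWaveSourceTorus_zero] at h

end Summit.HubbardSuperconductivity.HubbardSuperconductivity.Theorems
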